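import Summits.HodgeConjecture.HodgeConjecture.Theorems.MilnorKExponentialSymbolLiftRSymbolPullback
import Literature.AlgebraicGeometry.HodgeTheory.ComplexifiedDeRhamFamily
import Literature.Geometry.Manifold.DeRhamFundamentalClassPairing
import Literature.AlgebraicGeometry.HodgeTheory.HodgeModelExistenceProofs
import HarnessLib

/-!
# Symbol cocycles pull back along morphisms, on integration-scaled Hodge models

Theorems file of route `MilnorKExponential` of the Hodge summit, crux `SymbolLiftR`
(stmt-HodgeConjecture-18702), line `lefschetz-fold`, kernel `stub_primitiveLiftExists` (LIFT_p for
primitive rational `(p,p)` classes, `2 ≤ p ≤ n/2`, on an INTEGRATION-SCALED Hodge model: de Rham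
comparison `= (2πi)^{-k/2} •` integration `⊗ ℂ`).

`…SymbolLiftRSymbolPullback` pulls symbol cocycles back along endomorphisms of ONE variety, where
the naturality of the model's own comparison `A.deRham` applies. Along a morphism `ψ : Y ⟶ X`
between two varieties the carriers of the Hodge models `B` (of `Y`) and `A` (of `X`) are charted on
DIFFERENT model spaces and an arbitrary natural comparison says nothing; but the kernel is stated
for integration-scaled models, and integration is natural across model spaces (Lee Thm. 18.14,
tree `integrationDeRhamIsoFamily_map_of_contMDiff`). Hence:

* `complexify_integration_map_of_contMDiff` — the COMPLEXIFIED integration comparisons are natural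
  for `C^∞` maps between manifolds with different model spaces
  (`(∫ ⊗ ℂ)_M (f^* c) = f^* ((∫ ⊗ ℂ)_N c)`; `re`, `im`, `⊗ 1` commute with `f^*`);
* `HodgeModel.HasSymbolCocycle.map_of_integrationScaled` — **for `ψ : Y ⟶ X` between smooth
  projective varieties with integration-scaled Hodge models `A` of `X` and `B` of `Y`: if `c`
  carries a weight-`(q+1)` symbol cocycle on `A`, then `ψ^* c` carries one on `B`** (the symbol
  classes `L^*` of the census are stable under ALL pull-backs `ψ^*`, census S⁺₄(i));
* `HodgeModel.HasSymbolCocycle.transport_of_integrationScaled` — in particular (`ψ = 𝟙 X`) the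
  property `A.HasSymbolCocycle q c` does not depend on WHICH integration-scaled model of `X` is
  used: the `∃ A` of the kernel `stub_primitiveLiftExists` is a `∀ A` over integration-scaled models.

References: J. M. Lee, *Introduction to Smooth Manifolds* (2013), Thm. 18.14; C. Voisin, *Hodge
Theory I* (2002), §4.3.2 Rem. 4.48, §7.3.2; H. Esnault, E. Viehweg (1988), §7; J.-P. Serre, GAGA
(1956), §2 n°5.
-/

noncomputable section

-- The mandated namespace repeats `HodgeConjecture` (single-conjunct summit).
set_option linter.dupNamespace false
-- see "Implementation notes" in `…SingularHomology.SingularChainsConcrete`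
set_option backward.isDefEq.respectTransparency false

open scoped Manifold Topology ContDiff
open Set Function Filter

namespace Summit.HodgeConjecture.HodgeConjecture.Theorems.SymbolLiftR

open Literature.Geometry.Kaehler Literature.NumberTheory.Transcendental
open Literature.AlgebraicGeometry.HodgeTheory
open Literature.AlgebraicTopology.SingularHomology (singularCohomology)

universe u

/-! ### Cross-model naturality of the complexified integration comparison -/

section Naturality

variable {E : Type u} [NormedAddCommGroup E] [NormedSpace ℂ E] [FiniteDimensional ℂ E]
  {E' : Type u} [NormedAddCommGroup E'] [NormedSpace ℂ E'] [FiniteDimensional ℂ E']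
  {M : Type u} [TopologicalSpace M] [ChartedSpace E M] [IsManifold 𝓘(ℝ, E) ∞ M] [T2Space M]
  [SecondCountableTopology M] [LocallyCompactSpace M] [SigmaCompactSpace M]
  {N : Type u} [TopologicalSpace N] [ChartedSpace E' N] [IsManifold 𝓘(ℝ, E') ∞ N] [T2Space N]
  [SecondCountableTopology N] [LocallyCompactSpace N] [SigmaCompactSpace N]

/-- **The complexified integration comparisons are natural across model spaces**: for a `C^∞`
map `f : M → N` between manifolds charted on the (finite-dimensional complex, read as real) spaces
`E`, `E'`, `(∫ ⊗ ℂ)_M (f^* c) = f^* ((∫ ⊗ ℂ)_N c)` on `H^k_dR(N; ℂ)` — `re`, `im` and `⊗ 1`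
commute with `f^*` (`complexDeRhamCohomology.re_map/im_map`, `ofRealClass_map`) and integration is
natural across model spaces (`integrationDeRhamIsoFamily_map_of_contMDiff`, Lee Thm. 18.14).
[cite: LeeSmoothManifolds2013, Thm. 18.14] -/
theorem complexify_integration_map_of_contMDiff {f : M → N} (hf : ContMDiff 𝓘(ℝ, E) 𝓘(ℝ, E') ∞ f)
    (k : ℕ) (c : complexDeRhamCohomology E' N k) :
    (integrationDeRhamIsoFamily E).complexify M k (complexDeRhamCohomology.map E hf k c) =
      singularCohomology.map ℂ ℂ ⟨f, hf.continuous⟩ k ((integrationDeRhamIsoFamily E').complexify N k c) := by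
  haveI : FiniteDimensional ℝ E := FiniteDimensional.complexToReal E
  haveI : FiniteDimensional ℝ E' := FiniteDimensional.complexToReal E'
  rw [complexify_apply, complexify_apply, complexifyFun, complexDeRhamCohomology.re_map,
    complexDeRhamCohomology.im_map,
    Literature.Geometry.Manifold.integrationDeRhamIsoFamily_map_of_contMDiff hf k,
    Literature.Geometry.Manifold.integrationDeRhamIsoFamily_map_of_contMDiff hf k,
    ofRealClass_map, ofRealClass_map, complexifyFun, map_add, map_smul]

end Naturality

/-! ### Symbol cocycles on integration-scaled models pull back along morphisms -/

section HodgeModel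

open Literature.AlgebraicGeometry CategoryTheory

variable {n m : ℕ} {X Y : Motives.SchemeOver ℂ}

/-- **Symbol cocycles pull back along morphisms of smooth projective varieties, on
integration-scaled Hodge models.** Let `ψ : Y ⟶ X` be a morphism of smooth projective varieties,
`A` a Hodge model of `X` and `B` one of `Y`, both with comparison `(2πi)^{-k/2} •` (integration
`⊗ ℂ`) — the models of the kernel `stub_primitiveLiftExists`. If `c ∈ H^{2(q+1)}(X(ℂ); ℂ)` carries a
weight-`(q+1)` Milnor symbol cocycle on `A`, then `ψ^* c` carries one on `B`: pull the cover, the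
cocycle (`IsMilnorSymbolCocycle.comp`), the zig-zag (`IsTransgression.pullback`, re-topped by
`symbolForm_mapDomain_apply`) back along the holomorphic `ψ^an : Y^an → X^an`
(`HodgeModel.anMap`), and read the class through the cross-model naturality of integration
(`complexify_integration_map_of_contMDiff`) and `(ψ^an)^* ∘ A^* = B^* ∘ ψ(ℂ)^*`
(`HodgeModel.map_anMap_pullback`). [cite: EsnaultViehweg1988DB, §7] -/
theorem _root_.Literature.AlgebraicGeometry.HodgeTheory.HodgeModel.HasSymbolCocycle.map_of_integrationScaled
    (hX : Motives.IsSmoothProjective n X) (hY : Motives.IsSmoothProjective m Y)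
    (A : HodgeModel n X) (B : HodgeModel m Y)
    (hA : ∀ (k : ℕ) (y : complexDeRhamCohomology A.model A.carrier k),
      A.deRham A.carrier k y = ((2 * (Real.pi : ℂ) * Complex.I) ^ (k / 2))⁻¹ •
        (integrationDeRhamIsoFamily A.model).complexify A.carrier k y)
    (hB : ∀ (k : ℕ) (y : complexDeRhamCohomology B.model B.carrier k),
      B.deRham B.carrier k y = ((2 * (Real.pi : ℂ) * Complex.I) ^ (k / 2))⁻¹ •
        (integrationDeRhamIsoFamily B.model).complexify B.carrier k y)
    (ψ : Y ⟶ X) {q : ℕ} {c : complexBetti X (2 * (q + 1))} (h : A.HasSymbolCocycle q c) :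
    B.HasSymbolCocycle q (complexBetti.map ψ (2 * (q + 1)) c) := by
  -- topological instances on the two carriers (compact Hausdorff manifolds)
  haveI : CompactSpace A.carrier := by
    haveI := compactSpace_complexPoints_of_isSmoothProjective hX
    exact A.isAnalytification.homeomorph.symm.compactSpace
  haveI : CompactSpace B.carrier := by
    haveI := compactSpace_complexPoints_of_isSmoothProjective hY
    exact B.isAnalytification.homeomorph.symm.compactSpace
  haveI : SecondCountableTopology A.carrier := ChartedSpace.secondCountable_of_sigmaCompact A.model A.carrier
  haveI : SecondCountableTopology B.carrier := ChartedSpace.secondCountable_of_sigmaCompact B.model B.carrier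
  obtain ⟨ι, hι, U, hU, hcov, σ, hσ, θ, k, hk, hT, hdR⟩ := h
  set φ : B.carrier → A.carrier := HodgeModel.anMap A B ψ with hφdef
  have hφc : MDifferentiable 𝓘(ℂ, B.model) 𝓘(ℂ, A.model) φ := HodgeModel.mdifferentiable_anMap A B ψ hY hX
  have hφ : ContMDiff 𝓘(ℝ, B.model) 𝓘(ℝ, A.model) ∞ φ := HodgeModel.contMDiff_anMap A B ψ hY hX
  have hU' : ∀ i, IsOpen (φ ⁻¹' U i) := fun i ↦ (hU i).preimage hφ.continuous
  -- the pulled-back transgression, re-topped on the pulled-back cocycle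
  have hT' : IsTransgression hU' q
      (fun J ↦ symbolForm B.model (q + 1)
        (Finsupp.mapDomain (fun (t : Fin (q + 1) → A.carrier → ℂ) (i : Fin (q + 1)) ↦ t i ∘ φ) (σ J)))
      ((θ : MForm 𝓘(ℝ, A.model) A.carrier ℂ (2 * q + 1 + 1)).pullback 𝓘(ℝ, B.model) φ) := by
    refine (hT.pullback hφ).congr_top fun J y hy ↦ ?_
    have hy' : φ y ∈ cechSet U J := by rwa [cechSet_preimage] at hy
    exact (symbolForm_mapDomain_apply (isOpen_cechSet hU J) (fun t ht ↦ hσ.good J ht) hφ hy').symm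
  refine ⟨ι, hι, fun i ↦ φ ⁻¹' U i, hU', fun y ↦ hcov (φ y), _, hσ.comp hφc,
    ⟨(θ : MForm 𝓘(ℝ, A.model) A.carrier ℂ (2 * q + 1 + 1)).pullback 𝓘(ℝ, B.model) φ,
      pullback_mem_cclosedSmoothForms hφ θ.2⟩, k, hk, hT', ?_⟩
  -- the class: both comparisons are the same multiple of the (natural) integration comparison
  rw [hB, ← complexDeRhamCohomology.map_mk hφ θ, complexify_integration_map_of_contMDiff hφ, ← map_smul,
    ← hA, hdR, map_smul]
  congr 1
  exact HodgeModel.map_anMap_pullback A B ψ (2 * q + 1 + 1) c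

/-- **`HasSymbolCocycle` is independent of the integration-scaled model.** For two Hodge models
`A`, `B` of the same smooth projective `X`, both integration-scaled, a class carries a
weight-`(q+1)` symbol cocycle on `A` iff it does on `B` (the case `ψ = 𝟙 X` of
`map_of_integrationScaled`; `(𝟙 X)^* = id`). So the `∃ A` of the kernel `stub_primitiveLiftExists`
may be read as `∀ A` over integration-scaled models. [cite: EsnaultViehweg1988DB, §7] -/
theorem _root_.Literature.AlgebraicGeometry.HodgeTheory.HodgeModel.HasSymbolCocycle.transport_of_integrationScaled
    (hX : Motives.IsSmoothProjective n X) (A B : HodgeModel n X)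
    (hA : ∀ (k : ℕ) (y : complexDeRhamCohomology A.model A.carrier k),
      A.deRham A.carrier k y = ((2 * (Real.pi : ℂ) * Complex.I) ^ (k / 2))⁻¹ •
        (integrationDeRhamIsoFamily A.model).complexify A.carrier k y)
    (hB : ∀ (k : ℕ) (y : complexDeRhamCohomology B.model B.carrier k),
      B.deRham B.carrier k y = ((2 * (Real.pi : ℂ) * Complex.I) ^ (k / 2))⁻¹ •
        (integrationDeRhamIsoFamily B.model).complexify B.carrier k y)
    {q : ℕ} {c : complexBetti X (2 * (q + 1))} (h : A.HasSymbolCocycle q c) :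
    B.HasSymbolCocycle q c := by
  have h' := h.map_of_integrationScaled hX hX A B hA hB (𝟙 X)
  rwa [complexBetti.map_id] at h'

/-- **The symbol classes `L^{q+1}(X)` form an `End(X)`-submodule**: `IsSymbolClass n X q c →
IsSymbolClass n X q (ψ^* c)` for every endomorphism `ψ : X ⟶ X` of a smooth projective `X` (same
normalised model; `HasSymbolCocycle.map_endomorphism`). [cite: EsnaultViehweg1988DB, §7] -/
theorem _root_.Literature.AlgebraicGeometry.HodgeTheory.IsSymbolClass.map_endomorphism
    (hX : Motives.IsSmoothProjective n X) (ψ : X ⟶ X) {q : ℕ} {c : complexBetti X (2 * (q + 1))}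
    (h : IsSymbolClass n X q c) : IsSymbolClass n X q (complexBetti.map ψ (2 * (q + 1)) c) := by
  obtain ⟨A, hN, hc⟩ := h
  exact ⟨A, hN, hc.map_endomorphism hX A ψ⟩

end HodgeModel

/-- STUB `stub_hasSymbolCocycle_map_of_integrationScaled` (helper sub-goal registered on
stmt-HodgeConjecture-18702 for the kernel `stub_primitiveLiftExists`: on integration-scaled models
symbol cocycles pull back along every morphism of smooth projective varieties — S⁺₄(i) of the
census; with `ψ = 𝟙` the kernel's `∃ A` is a `∀ A`): `HodgeModel.HasSymbolCocycle.map_of_integrationScaled`,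
stated closed. [cite: EsnaultViehweg1988DB, §7] -/
theorem stub_hasSymbolCocycle_map_of_integrationScaled : ∀ {n m : ℕ} {X Y : Literature.AlgebraicGeometry.Motives.SchemeOver ℂ}, Literature.AlgebraicGeometry.Motives.IsSmoothProjective n X → Literature.AlgebraicGeometry.Motives.IsSmoothProjective m Y → ∀ (A : Literature.AlgebraicGeometry.HodgeTheory.HodgeModel n X) (B : Literature.AlgebraicGeometry.HodgeTheory.HodgeModel m Y), (∀ (k : ℕ) (y : complexDeRhamCohomology A.model A.carrier k), A.deRham A.carrier k y = ((2 * (Real.pi : ℂ) * Complex.I) ^ (k / 2))⁻¹ • (integrationDeRhamIsoFamily A.model).complexify A.carrier k y) → (∀ (k : ℕ) (y : complexDeRhamCohomology B.model B.carrier k), B.deRham B.carrier k y = ((2 * (Real.pi : ℂ) * Complex.I) ^ (k / 2))⁻¹ • (integrationDeRhamIsoFamily B.model).complexify B.carrier k y) → ∀ (ψ : Y ⟶ X) {q : ℕ} {c : Literature.AlgebraicGeometry.HodgeTheory.complexBetti X (2 * (q + 1))}, A.HasSymbolCocycle q c → B.HasSymbolCocycle q (Literature.AlgebraicGeometry.HodgeTheory.complexBetti.map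 ψ (2 * (q + 1)) c) :=
  fun hX hY A B hA hB ψ _ _ h ↦ h.map_of_integrationScaled hX hY A B hA hB ψ

end Summit.HodgeConjecture.HodgeConjecture.Theorems.SymbolLiftR

end
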